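import Mathlib
import Literature.RingTheory.Derivation.WronskianPurity
import HarnessLib

/-!
# A derivation with `D t = 1` makes `1, t, …, t^{p-1}` a basis

Topic: `Literature/RingTheory/Derivation`. Let `R → S` be a local homomorphism of local rings with
`S` finite free of rank `p` over `R`, `0!, …, (p-1)!` units of `R`, and `D` an `R`-derivation of
`S` with `D t = 1`. Then `1, t, …, t^{p-1}` is an `R`-basis of `S` (`exists_basis_pow_of_derivation_eq_one`):
applying `D^j` to a relation `Σ cᵢ tⁱ ∈ 𝔪S` shows all `cᵢ ∈ 𝔪` (`coeff_mem_maximalIdeal_of_sum_pow_mem`), so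
the powers are independent in `S/𝔪S`, span it by a dimension count, and span `S` by Nakayama.
With the iterate formulas `D^j (t^l) = l!/(l-j)! t^{l-j}`. Brick of the rank-`p` Kimura–Niitsuma
argument (Matsumura, *Commutative Ring Theory*, end of §26).

References: H. Matsumura, *Commutative Ring Theory*, CUP 1986, Thm. 2.2 (Nakayama), §26.
Elementary; no named facts.
-/

namespace Literature.RingTheory.Derivation

open Polynomial IsLocalRing Module

/-! ### 4. Monogenicity from `D t = 1` -/

section Monogenic

variable {R S : Type*} [CommRing R] [CommRing S] [Algebra R S]

/-- `D^j (t^l) = l!/(l-j)! · t^(l-j)` for `j ≤ l` when `D t = 1`. [folklore] -/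
theorem derivation_iterate_pow (D : Derivation R S S) {t : S} (ht : D t = 1) {j l : ℕ}
    (hjl : j ≤ l) : (D : S → S)^[j] (t ^ l) = (l.descFactorial j : S) * t ^ (l - j) := by
  induction j with
  | zero =>
    rw [Function.iterate_zero_apply, Nat.descFactorial_zero, Nat.cast_one, one_mul, Nat.sub_zero]
  | succ j ih =>
    rw [Function.iterate_succ_apply', ih (Nat.le_of_succ_le hjl), Derivation.leibniz, smul_eq_mul,
      smul_eq_mul, Derivation.map_natCast, mul_zero, add_zero, Derivation.leibniz_pow, ht,
      smul_eq_mul, mul_one, nsmul_eq_mul, Nat.descFactorial_succ, Nat.cast_mul,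
      show l - j - 1 = l - (j + 1) by omega]
    ring

/-- `D^l (t^l) = l!` when `D t = 1`. [folklore] -/
theorem derivation_iterate_pow_self (D : Derivation R S S) {t : S} (ht : D t = 1) (l : ℕ) :
    (D : S → S)^[l] (t ^ l) = (l.factorial : S) := by
  rw [derivation_iterate_pow D ht le_rfl, Nat.descFactorial_self, Nat.sub_self, pow_zero, mul_one]

/-- `D^j (t^l) = 0` for `j > l` when `D t = 1`. [folklore] -/
theorem derivation_iterate_pow_of_lt (D : Derivation R S S) {t : S} (ht : D t = 1) {j l : ℕ}
    (hjl : l < j) : (D : S → S)^[j] (t ^ l) = 0 := by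
  obtain ⟨a, rfl⟩ : ∃ a, j = a + (l + 1) := ⟨j - (l + 1), by omega⟩
  rw [Function.iterate_add_apply, Function.iterate_succ_apply', derivation_iterate_pow_self D ht,
    Derivation.map_natCast]
  exact Function.iterate_fixed (map_zero D) a

/-- An `R`-derivation of `S` preserves `IS` for any ideal `I` of `R`. [folklore] -/
theorem derivation_apply_mem_ideal_map (D : Derivation R S S) (I : Ideal R) {x : S}
    (hx : x ∈ I.map (algebraMap R S)) : D x ∈ I.map (algebraMap R S) := by
  induction hx using Submodule.span_induction with
  | mem y hy =>
    obtain ⟨r, -, rfl⟩ := hy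
    rw [Derivation.map_algebraMap]
    exact Ideal.zero_mem _
  | zero => rw [map_zero]; exact Ideal.zero_mem _
  | add y z _ _ hy hz => rw [map_add]; exact Ideal.add_mem _ hy hz
  | smul a y hy' hy =>
    rw [smul_eq_mul, Derivation.leibniz, smul_eq_mul, smul_eq_mul]
    exact Ideal.add_mem _ (Ideal.mul_mem_left _ _ hy) (Ideal.mul_mem_right _ _ hy')

/-- Iterates of an `R`-derivation of `S` preserve `IS`. [folklore] -/
theorem derivation_iterate_mem_ideal_map (D : Derivation R S S) (I : Ideal R) (j : ℕ) {x : S}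
    (hx : x ∈ I.map (algebraMap R S)) : (D : S → S)^[j] x ∈ I.map (algebraMap R S) := by
  induction j with
  | zero => exact hx
  | succ j ih => rw [Function.iterate_succ_apply']; exact derivation_apply_mem_ideal_map D I ih

variable [IsLocalRing R] [IsLocalRing S] [IsLocalHom (algebraMap R S)]

/-- Along a local homomorphism, `algebraMap r ∈ 𝔪S` forces `r ∈ 𝔪`. [folklore] -/
theorem mem_maximalIdeal_of_algebraMap_mem_map {r : R}
    (hr : algebraMap R S r ∈ (maximalIdeal R).map (algebraMap R S)) : r ∈ maximalIdeal R := by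
  have h1 : algebraMap R S r ∈ maximalIdeal S :=
    (Ideal.map_le_iff_le_comap.mpr
      (fun x hx => Ideal.mem_comap.mpr (map_nonunit (algebraMap R S) x hx))) hr
  rw [mem_maximalIdeal] at h1 ⊢
  exact fun hu => h1 (hu.map _)

/-- **Coefficients of a relation lie in `𝔪`.** If `D t = 1` and `Σ_{i<m} cᵢ tⁱ ∈ 𝔪S` with
`m ≤ p` and `0!, …, (p-1)!` units of `R`, then all `cᵢ ∈ 𝔪` (apply `D^{m-1}` and induct).
[folklore] -/
theorem coeff_mem_maximalIdeal_of_sum_pow_mem (D : Derivation R S S) {t : S} (ht : D t = 1) {p : ℕ}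
    (hfact : ∀ n : ℕ, n < p → IsUnit ((n.factorial : ℕ) : R)) :
    ∀ (m : ℕ), m ≤ p → ∀ (c : ℕ → R),
      (∑ i ∈ Finset.range m, c i • t ^ i) ∈ (maximalIdeal R).map (algebraMap R S) →
      ∀ i, i < m → c i ∈ maximalIdeal R := by
  intro m
  induction m with
  | zero => intro _ _ _ i hi; omega
  | succ m ih =>
    intro hm c hc i hi
    have htop : c m ∈ maximalIdeal R := by
      have h1 := derivation_iterate_mem_ideal_map D (maximalIdeal R) m hc
      have h2 : (D : S → S)^[m] (∑ i ∈ Finset.range (m + 1), c i • t ^ i) =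
          algebraMap R S (c m * (m.factorial : ℕ)) := by
        rw [derivation_iterate_eq_pow_apply, map_sum, Finset.sum_range_succ, Finset.sum_eq_zero, zero_add,
          map_smul, ← derivation_iterate_eq_pow_apply, derivation_iterate_pow_self D ht, map_mul,
          map_natCast, Algebra.smul_def]
        intro i hi
        rw [Finset.mem_range] at hi
        rw [map_smul, ← derivation_iterate_eq_pow_apply, derivation_iterate_pow_of_lt D ht hi, smul_zero]
      rw [h2] at h1
      have h3 := mem_maximalIdeal_of_algebraMap_mem_map h1
      exact (Ideal.IsPrime.mem_or_mem inferInstance h3).resolve_right fun h4 =>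
        (mem_maximalIdeal _).mp h4 (hfact m (by omega))
    rcases Nat.lt_succ_iff_lt_or_eq.mp hi with hi' | rfl
    · refine ih (by omega) c ?_ i hi'
      have h4 : ∑ i ∈ Finset.range m, c i • t ^ i =
          ∑ i ∈ Finset.range (m + 1), c i • t ^ i - c m • t ^ m := by
        rw [Finset.sum_range_succ, add_sub_cancel_right]
      rw [h4]
      refine Ideal.sub_mem _ hc ?_
      rw [Algebra.smul_def]
      exact Ideal.mul_mem_right _ _ (Ideal.mem_map_of_mem _ htop)
    · exact htop

/-- **Monogenicity.** If `S` is finite free of rank `p` over the local ring `R` along a local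
homomorphism, `0!, …, (p-1)!` are units of `R`, and `D t = 1` for an `R`-derivation `D` of `S`,
then `1, t, …, t^{p-1}` is an `R`-basis of `S` (independence mod `𝔪S` by
`coeff_mem_maximalIdeal_of_sum_pow_mem`, then Nakayama). [folklore] -/
theorem exists_basis_pow_of_derivation_eq_one [Module.Finite R S] [Module.Free R S] {p : ℕ}
    (hrank : finrank R S = p) (hfact : ∀ n : ℕ, n < p → IsUnit ((n.factorial : ℕ) : R))
    (D : Derivation R S S) {t : S} (ht : D t = 1) :
    ∃ b : Basis (Fin p) R S, ∀ i, b i = t ^ (i : ℕ) := by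
  classical
  set 𝔪 := maximalIdeal R
  set 𝔪S := (maximalIdeal R).map (algebraMap R S)
  letI : Field (R ⧸ 𝔪) := Ideal.Quotient.field 𝔪
  let v : Fin p → S ⧸ 𝔪S := fun i => Ideal.Quotient.mk 𝔪S (t ^ (i : ℕ))
  have hli : LinearIndependent (R ⧸ 𝔪) v := by
    rw [Fintype.linearIndependent_iff]
    intro g hg i
    choose c hc using fun i => Ideal.Quotient.mk_surjective (g i)
    let c' : ℕ → R := fun i => if h : i < p then c ⟨i, h⟩ else 0
    have hsum : ∑ i ∈ Finset.range p, c' i • t ^ i ∈ 𝔪S := by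
      rw [← Ideal.Quotient.eq_zero_iff_mem, ← hg, map_sum,
        ← Fin.sum_univ_eq_sum_range (fun i => Ideal.Quotient.mk 𝔪S (c' i • t ^ i)) p]
      refine Finset.sum_congr rfl fun i _ => ?_
      simp only [c', dif_pos i.2, Fin.eta, v]
      rw [← hc i, Ideal.Quotient.mk_smul_mk_quotient_map_quotient, Algebra.smul_def]
    have h := coeff_mem_maximalIdeal_of_sum_pow_mem D ht hfact p le_rfl c' hsum i i.2
    simp only [c', dif_pos i.2, Fin.eta] at h
    rw [← hc i]
    exact Ideal.Quotient.eq_zero_iff_mem.mpr h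
  have hfin : finrank (R ⧸ 𝔪) (S ⧸ 𝔪S) = p := by rw [IsLocalRing.finrank_quotient_map, hrank]
  haveI : Module.Finite (R ⧸ 𝔪) (S ⧸ 𝔪S) := Module.Finite.of_restrictScalars_finite R _ _
  have hcard : Fintype.card (Fin p) = finrank (R ⧸ 𝔪) (S ⧸ 𝔪S) := by
    rw [Fintype.card_fin, hfin]
  have hspan : Submodule.span (R ⧸ 𝔪) (Set.range v) = ⊤ :=
    hli.span_eq_top_of_card_eq_finrank' hcard
  have hspanS : Submodule.span R (Set.range fun i : Fin p => t ^ (i : ℕ)) = ⊤ := by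
    rw [← IsLocalRing.quotient_span_eq_top_iff_span_eq_top, ← Set.range_comp]
    exact hspan
  refine ⟨basisOfTopLeSpanOfCardEqFinrank (fun i : Fin p => t ^ (i : ℕ)) hspanS.ge
    (by rw [Fintype.card_fin, hrank]), fun i => ?_⟩
  rw [coe_basisOfTopLeSpanOfCardEqFinrank]

end Monogenic

end Literature.RingTheory.Derivation
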